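import Summits.QuantumFields.BalabanUV.T4Continuum.Support.NE3SquaredTentProfile
import HarnessLib

/-!
# T⁴ programme, node NE3 — census R32 (exact half, step 2b, file 2): THE SQUARED-TENT BUMP — fixing BLOCK MEANS with a profile that is
# `C¹` across the block faces: coboundary `O(1∕M)`, SECOND differences `O(1∕M²)` times the local datum

Cell `pub-balaban-gaps` (track G2, seat `ne3`; writer prover-pub-balaban-gaps-ne3-g6-0, 2026-08-23), census `run/shared/lean/pub/pub-balaban-gaps/ne/NE3.md`
§4 R32.  Over file 1 `NE3SquaredTentProfile` (the squared profile is `C¹` across faces) BY NAME.  THIS FILE: **`bump2 M c y := (tent M y)² • c (blk M y)`**;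
periodicity (`bump2_add_period`); the block sum **`sum_block_bump2`** `Σ_{v∈[0,M)^d} bump2 M c (M•z + v) = tentSum2 d M • c z` with
`tentSum2 d M = (Σ_{t<M} ((t∕M)(1−t∕M))²)^d ≥ (M∕64)^d` (**`le_tentSum2`**, Cauchy–Schwarz against the tree's `tentSum_eq`; `tentSum2_pos`); the
coboundary **`norm_dPot_bump2_le`** `‖dPot (bump2 M c) y α‖ ≤ (2∕M)·‖c (blk M y)‖` and its energy **`sum_normSq_dPot_bump2_le`**
`≤ 4d·(M^d∕M²)·Σ_{z∈periodBox N} ‖c z‖²`; THE SECOND DIFFERENCES **`norm_sdiff_bump2_le`** (`M ≥ 2`)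
`‖dPot (bump2 M c) y μ − dPot (bump2 M c) (y − e_μ) μ‖ ≤ (6∕M²)·(‖c (blk M y)‖ + ‖c (blk M (y − e_μ))‖)` (three cases: entering slice, last slice,
interior) and the flat-Laplacian energy **`sum_normSq_lap_bump2_le`**
`Σ_{y∈periodBox (M·N)} ‖Σ_μ (dPot (bump2 M c) y μ − dPot (bump2 M c) (y − e_μ) μ)‖² ≤ 144·d²·(M^d∕M⁴)·Σ_{z∈periodBox N} ‖c z‖²` — the `M^{d−4}`
currency.  Consumed by `NE3SmoothBlockMeanInterpolant`.

CONTENT ([folklore] lattice calculus; 0 sorry; DATA defs `tentSum2`, `bump2`), `𝔸` a real normed ring-module.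

HONEST FRAMING.  Pure lattice calculus; nothing about Bałaban's minimisers; (P♮) on `slicB8`, T-E_w and **NE3 are NOT proved** here; spine
PROVED 0∕9; finite T⁴ rung (B)+1 — NOT continuum YM on ℝ⁴, NOT infinite volume, NOT mass gap, NOT Clay.
PLACEMENT: `Summits/QuantumFields/BalabanUV/T4Continuum/Support/`.
-/

set_option autoImplicit false

open scoped BigOperators
open Finset

namespace Summit.QuantumFields.BalabanUV.T4Continuum.NE3SquaredTentBump

open Literature.MathematicalPhysics.QuantumFieldTheory.Balaban1983to89
open B7Prop1Explicit
open T4AveragingDeficitWallBoundary (periodBox mem_periodBox card_periodBox sum_periodBox_shift)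
open SmoothRefineBlocks (blk res res_nonneg res_lt res_le blk_boxVec res_boxVec blk_res_smul blk_res_add_period blk_add_e
  res_add_e_self res_add_e_ne)
open SmoothRefineInterp (wt wt_nonneg wt_le_one)
open NE3BlockLineAverage (sum_univ_boxVec sum_periodBox_blocks)
open NE3TangentNoGoWords (dPot)
open NE3CoarseInterpolant (blk_block)
open NE3TentBump (fac fac_nonneg fac_le_one wt_eq fac_le_inv_of_res_eq fac_eq_zero_of_res_eq_zero abs_fac_step_le tent tent_nonneg
  tent_le_one tent_eq_zero_of_res_eq_zero tent_le_inv_of_res_eq abs_tent_step_le tentSum tentSum_eq)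
open NE3BlockMeanExactInterpolant (normSq_sum_le_card_mul)
open NE3SquaredTentProfile (res_blk_sub_e_of_res_eq_zero res_blk_sub_e_of_res_ne_zero abs_tentSq_step_le tentSq_le_of_res_eq
  abs_tentSq_sdiff_le)

noncomputable section

variable {d : ℕ}

/-! ## §3 The squared-tent bump: block sums and the coboundary -/

/-- THE BLOCK SUM OF THE SQUARED TENT: `tentSum2 d M = (Σ_{t<M} ((t∕M)(1 − t∕M))²)^d`. [folklore] -/
def tentSum2 (d M : ℕ) : ℝ := (∑ t : Fin M, (((t : ℕ) : ℝ) / M * (1 - ((t : ℕ) : ℝ) / M)) ^ 2) ^ d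

/-- On the block `M•z + [0,M)^d` the squared tent sums to `tentSum2 d M`. [folklore] -/
theorem sum_block_tentSq {M : ℕ} (hM : 1 ≤ M) (z : Site d) :
    ∑ v ∈ periodBox (d := d) M, tent M ((M : ℤ) • z + v) ^ 2 = tentSum2 d M := by
  rw [← sum_univ_boxVec M (fun v => tent M ((M : ℤ) • z + v) ^ 2)]
  have hterm : ∀ r : Fin d → Fin M, tent M ((M : ℤ) • z + boxVec M r) ^ 2
      = ∏ i : Fin d, (((r i : ℕ) : ℝ) / M * (1 - ((r i : ℕ) : ℝ) / M)) ^ 2 := by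
    intro r
    unfold tent fac
    rw [← Finset.prod_pow]
    refine Finset.prod_congr rfl fun i _ => ?_
    rw [wt_eq, res_boxVec hM z r]
    simp [boxVec]
  rw [Finset.sum_congr rfl fun r _ => hterm r, tentSum2, ← Fintype.piFinset_univ,
    ← Finset.prod_univ_sum (fun _ : Fin d => (Finset.univ : Finset (Fin M)))
      (fun _ (t : Fin M) => (((t : ℕ) : ℝ) / M * (1 - ((t : ℕ) : ℝ) / M)) ^ 2),
    Finset.prod_const, Finset.card_univ, Fintype.card_fin]

/-- **`(M∕64)^d ≤ tentSum2 d M`** for `M ≥ 2` (Cauchy–Schwarz against `Σ_{t<M} (t∕M)(1−t∕M) = (M²−1)∕(6M)`). [folklore] -/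
theorem le_tentSum2 {M : ℕ} (hM : 2 ≤ M) (d : ℕ) : ((M : ℝ) / 64) ^ d ≤ tentSum2 d M := by
  have hM1 : 1 ≤ M := by omega
  have hM2 : (2 : ℝ) ≤ M := by exact_mod_cast hM
  have hM0 : (0 : ℝ) < M := by linarith
  unfold tentSum2
  refine pow_le_pow_left₀ (by positivity) ?_ d
  -- `(Σ a_t)² ≤ M · Σ a_t²` with `Σ a_t = (M² − 1)/(6M)`
  have hsum : ∑ t : Fin M, ((t : ℕ) : ℝ) / M * (1 - ((t : ℕ) : ℝ) / M) = ((M : ℝ) ^ 2 - 1) / (6 * M) := by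
    have h := tentSum_eq hM1 1
    unfold tentSum at h
    rwa [pow_one, pow_one] at h
  have hCS := sq_sum_le_card_mul_sum_sq (s := (Finset.univ : Finset (Fin M)))
    (f := fun t : Fin M => ((t : ℕ) : ℝ) / M * (1 - ((t : ℕ) : ℝ) / M))
  rw [Finset.card_univ, Fintype.card_fin, hsum] at hCS
  -- `((M²−1)/(6M))² ≥ M²/64` for `M ≥ 2`, hence `Σ a_t² ≥ M/64`
  have hkey : (M : ℝ) / 64 * M ≤ (((M : ℝ) ^ 2 - 1) / (6 * M)) ^ 2 := by
    rw [div_pow, div_mul_eq_mul_div, div_le_div_iff₀ (by norm_num) (by positivity)]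
    have hM4 : (4 : ℝ) ≤ (M : ℝ) ^ 2 := by nlinarith
    nlinarith [hM4, pow_nonneg hM0.le 2, pow_nonneg hM0.le 4]
  have h2 : (M : ℝ) * ((M : ℝ) / 64) ≤ (M : ℝ) * ∑ t : Fin M, (((t : ℕ) : ℝ) / M * (1 - ((t : ℕ) : ℝ) / M)) ^ 2 := by
    rw [mul_comm ((M : ℝ))]
    exact hkey.trans hCS
  exact le_of_mul_le_mul_left h2 hM0

/-- **`0 < tentSum2 d M`** for `M ≥ 2`. [folklore] -/
theorem tentSum2_pos {M : ℕ} (hM : 2 ≤ M) (d : ℕ) : 0 < tentSum2 d M := by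
  have hM0 : (0 : ℝ) < M := by exact_mod_cast (by omega : 0 < M)
  exact lt_of_lt_of_le (by positivity) (le_tentSum2 hM d)

section Bump

variable {𝔸 : Type*} [NormedRing 𝔸] [NormedSpace ℝ 𝔸]

/-- THE SQUARED-TENT BUMP carrying the coarse datum `c`: `bump2 M c y = (tent M y)² • c (blk M y)`. [folklore] -/
def bump2 (M : ℕ) (c : Site d → 𝔸) (y : Site d) : 𝔸 := tent M y ^ 2 • c (blk M y)

/-- The bump vanishes where some offset coordinate vanishes (entering slices, corners). [folklore] -/
theorem bump2_of_res_eq_zero (M : ℕ) (c : Site d → 𝔸) {y : Site d} {i : Fin d} (h : res M y i = 0) : bump2 M c y = 0 := by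
  unfold bump2; rw [tent_eq_zero_of_res_eq_zero h, zero_pow two_ne_zero, zero_smul]

/-- **THE BLOCK SUM OF THE SQUARED-TENT BUMP**: `Σ_{v∈[0,M)^d} bump2 M c (M•z + v) = tentSum2 d M • c z`. [folklore] -/
theorem sum_block_bump2 {M : ℕ} (hM : 1 ≤ M) (c : Site d → 𝔸) (z : Site d) :
    ∑ v ∈ periodBox (d := d) M, bump2 M c ((M : ℤ) • z + v) = tentSum2 d M • c z := by
  unfold bump2
  rw [Finset.sum_congr rfl fun v hv => by rw [blk_block hM z hv], ← Finset.sum_smul, sum_block_tentSq hM z]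

/-- Periodicity: an `N`-periodic datum gives an `(M·N)`-periodic squared-tent bump. [folklore] -/
theorem bump2_add_period {M : ℕ} (hM : 1 ≤ M) {N : ℕ} {c : Site d → 𝔸}
    (hc : ∀ (z : Site d) (τ : Fin d), c (z + (N : ℤ) • e τ) = c z) (y : Site d) (τ : Fin d) :
    bump2 M c (y + ((M * N : ℕ) : ℤ) • e τ) = bump2 M c y := by
  obtain ⟨hb, hr⟩ := blk_res_add_period (d := d) hM y (N : ℤ) τ
  have hP : ((M * N : ℕ) : ℤ) = (M : ℤ) * (N : ℤ) := by push_cast; ring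
  have ht : tent M (y + ((M : ℤ) * (N : ℤ)) • e τ) = tent M y := by
    unfold tent fac; simp only [wt_eq, hr]
  unfold bump2
  rw [hP, ht, hb, hc]

omit [NormedSpace ℝ 𝔸] in
/-- The datum read through the blocks, `y ↦ ‖c (blk M y)‖²`, is `(M·N)`-periodic for `N`-periodic `c`. [folklore] -/
theorem normSq_blk_add_period {M : ℕ} (hM : 1 ≤ M) {N : ℕ} {c : Site d → 𝔸}
    (hc : ∀ (z : Site d) (τ : Fin d), c (z + (N : ℤ) • e τ) = c z) (y : Site d) (τ : Fin d) :
    ‖c (blk M (y + ((M * N : ℕ) : ℤ) • e τ))‖ ^ 2 = ‖c (blk M y)‖ ^ 2 := by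
  have hP : ((M * N : ℕ) : ℤ) = (M : ℤ) * (N : ℤ) := by push_cast; ring
  rw [hP, (blk_res_add_period (d := d) hM y (N : ℤ) τ).1, hc]

/-- **THE COBOUNDARY OF THE SQUARED-TENT BUMP IS `O(1∕M)` TIMES THE LOCAL DATUM**: `‖dPot (bump2 M c) y α‖ ≤ (2∕M)·‖c (blk M y)‖`. [folklore] -/
theorem norm_dPot_bump2_le {M : ℕ} (hM : 1 ≤ M) (c : Site d → 𝔸) (y : Site d) (α : Fin d) :
    ‖dPot (bump2 M c) y α‖ ≤ (2 / (M : ℝ)) * ‖c (blk M y)‖ := by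
  have hM0 : (0 : ℝ) < M := by exact_mod_cast (by omega : 0 < M)
  have hM1 : (1 : ℝ) ≤ M := by exact_mod_cast hM
  simp only [dPot, bump2]
  by_cases h : res M y α = (M : ℤ) - 1
  · -- crossing a face: the arriving site has `ρ_α = 0`
    have hres' : res M (y + e α) α = 0 := by rw [res_add_e_self hM, if_pos h]
    rw [tent_eq_zero_of_res_eq_zero hres', zero_pow two_ne_zero, zero_smul, zero_sub, norm_neg, norm_smul,
      Real.norm_of_nonneg (sq_nonneg _)]
    refine mul_le_mul_of_nonneg_right ((tentSq_le_of_res_eq hM h).trans ?_) (norm_nonneg _)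
    rw [div_le_div_iff₀ (by positivity) hM0]
    nlinarith
  · -- inside the block
    have hblk : blk M (y + e α) = blk M y := by rw [blk_add_e hM, if_neg h, add_zero]
    rw [hblk, ← sub_smul, norm_smul, Real.norm_eq_abs]
    exact mul_le_mul_of_nonneg_right (abs_tentSq_step_le hM h) (norm_nonneg _)

/-- **THE DIRICHLET ENERGY OF THE SQUARED-TENT BUMP** over the torus of side `M·N`:
`Σ_{y∈periodBox (M·N)} Σ_α ‖dPot (bump2 M c) y α‖² ≤ 4d·(M^d∕M²)·Σ_{z∈periodBox N} ‖c z‖²` (`M ≥ 1`). [folklore] -/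
theorem sum_normSq_dPot_bump2_le {M : ℕ} (hM : 1 ≤ M) (N : ℕ) (c : Site d → 𝔸) :
    ∑ y ∈ periodBox (d := d) (M * N), ∑ α : Fin d, ‖dPot (bump2 M c) y α‖ ^ 2
      ≤ 4 * (d : ℝ) * ((M : ℝ) ^ d / (M : ℝ) ^ 2) * ∑ z ∈ periodBox (d := d) N, ‖c z‖ ^ 2 := by
  have hM0 : (0 : ℝ) < M := by exact_mod_cast (by omega : 0 < M)
  have hpt : ∀ (y : Site d) (α : Fin d), ‖dPot (bump2 M c) y α‖ ^ 2 ≤ (4 / (M : ℝ) ^ 2) * ‖c (blk M y)‖ ^ 2 := by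
    intro y α
    have h := norm_dPot_bump2_le hM c y α
    calc ‖dPot (bump2 M c) y α‖ ^ 2 ≤ ((2 / (M : ℝ)) * ‖c (blk M y)‖) ^ 2 := pow_le_pow_left₀ (norm_nonneg _) h 2
      _ = (4 / (M : ℝ) ^ 2) * ‖c (blk M y)‖ ^ 2 := by ring
  calc ∑ y ∈ periodBox (d := d) (M * N), ∑ α : Fin d, ‖dPot (bump2 M c) y α‖ ^ 2
      ≤ ∑ y ∈ periodBox (d := d) (M * N), ∑ _α : Fin d, (4 / (M : ℝ) ^ 2) * ‖c (blk M y)‖ ^ 2 :=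
        Finset.sum_le_sum fun y _ => Finset.sum_le_sum fun α _ => hpt y α
    _ = ∑ z ∈ periodBox (d := d) N, ∑ v ∈ periodBox (d := d) M, (d : ℝ) * ((4 / (M : ℝ) ^ 2) * ‖c z‖ ^ 2) := by
        rw [← sum_periodBox_blocks M N hM]
        refine Finset.sum_congr rfl fun z _ => Finset.sum_congr rfl fun v hv => ?_
        rw [blk_block hM z hv, Finset.sum_const, Finset.card_univ, Fintype.card_fin, nsmul_eq_mul]
    _ = 4 * (d : ℝ) * ((M : ℝ) ^ d / (M : ℝ) ^ 2) * ∑ z ∈ periodBox (d := d) N, ‖c z‖ ^ 2 := by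
        rw [Finset.mul_sum]
        refine Finset.sum_congr rfl fun z _ => ?_
        rw [Finset.sum_const, card_periodBox, nsmul_eq_mul]
        push_cast
        field_simp

/-! ## §4 The second differences of the squared-tent bump -/

/-- **THE SECOND DIFFERENCES OF THE SQUARED-TENT BUMP ARE `O(1∕M²)` TIMES THE LOCAL DATA** (`M ≥ 2`):
`‖dPot (bump2 M c) y μ − dPot (bump2 M c) (y − e_μ) μ‖ ≤ (6∕M²)·(‖c (blk M y)‖ + ‖c (blk M (y − e_μ))‖)`. [folklore] -/
theorem norm_sdiff_bump2_le {M : ℕ} (hM : 2 ≤ M) (c : Site d → 𝔸) (y : Site d) (μ : Fin d) :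
    ‖dPot (bump2 M c) y μ - dPot (bump2 M c) (y - e μ) μ‖
      ≤ (6 / (M : ℝ) ^ 2) * (‖c (blk M y)‖ + ‖c (blk M (y - e μ))‖) := by
  have hM1 : 1 ≤ M := by omega
  have hM0 : (0 : ℝ) < M := by exact_mod_cast (by omega : 0 < M)
  have h6 : 0 ≤ 6 / (M : ℝ) ^ 2 := by positivity
  have hcy := norm_nonneg (c (blk M y))
  have hcy' := norm_nonneg (c (blk M (y - e μ)))
  simp only [dPot, sub_add_cancel]
  by_cases h0 : res M y μ = 0
  · -- entering slice: `bump2 y = 0`, the two neighbours are on the second and on the previous last slice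
    obtain ⟨hr', hb'⟩ := res_blk_sub_e_of_res_eq_zero hM1 h0
    have hne : res M y μ ≠ (M : ℤ) - 1 := by rw [h0]; omega
    have hblk : blk M (y + e μ) = blk M y := by rw [blk_add_e hM1, if_neg hne, add_zero]
    have hty : tent M y = 0 := tent_eq_zero_of_res_eq_zero h0
    have ht1 : tent M (y + e μ) ^ 2 ≤ 1 / (M : ℝ) ^ 2 := by
      have h := abs_tent_step_le hM1 hne
      rw [hty, sub_zero, abs_of_nonneg (tent_nonneg hM1 _)] at h
      calc tent M (y + e μ) ^ 2 ≤ (1 / (M : ℝ)) ^ 2 := pow_le_pow_left₀ (tent_nonneg hM1 _) h 2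
        _ = 1 / (M : ℝ) ^ 2 := by rw [div_pow, one_pow]
    have ht2 : tent M (y - e μ) ^ 2 ≤ 1 / (M : ℝ) ^ 2 := tentSq_le_of_res_eq hM1 hr'
    simp only [bump2, hty, zero_pow two_ne_zero, zero_smul, sub_zero, zero_sub, sub_neg_eq_add, hblk]
    calc ‖tent M (y + e μ) ^ 2 • c (blk M y) + tent M (y - e μ) ^ 2 • c (blk M (y - e μ))‖
        ≤ ‖tent M (y + e μ) ^ 2 • c (blk M y)‖ + ‖tent M (y - e μ) ^ 2 • c (blk M (y - e μ))‖ := norm_add_le _ _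
      _ = tent M (y + e μ) ^ 2 * ‖c (blk M y)‖ + tent M (y - e μ) ^ 2 * ‖c (blk M (y - e μ))‖ := by
          rw [norm_smul, norm_smul, Real.norm_of_nonneg (sq_nonneg _), Real.norm_of_nonneg (sq_nonneg _)]
      _ ≤ 1 / (M : ℝ) ^ 2 * ‖c (blk M y)‖ + 1 / (M : ℝ) ^ 2 * ‖c (blk M (y - e μ))‖ := by gcongr
      _ ≤ (6 / (M : ℝ) ^ 2) * (‖c (blk M y)‖ + ‖c (blk M (y - e μ))‖) := by
          rw [mul_add]
          gcongr <;> norm_num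
  · obtain ⟨hr', hb'⟩ := res_blk_sub_e_of_res_ne_zero hM1 h0
    simp only [bump2, hb']
    by_cases h1 : res M y μ = (M : ℤ) - 1
    · -- last slice: `bump2 (y + e) = 0`
      have hres'' : res M (y + e μ) μ = 0 := by rw [res_add_e_self hM1, if_pos h1]
      have hne' : res M (y - e μ) μ ≠ (M : ℤ) - 1 := by rw [hr', h1]; omega
      have hty : tent M y ≤ 1 / (M : ℝ) := tent_le_inv_of_res_eq hM1 h1
      have hty' : tent M (y - e μ) ≤ 2 / (M : ℝ) := by
        have h := abs_tent_step_le hM1 hne'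
        rw [sub_add_cancel, abs_le] at h
        have h2 : (2 : ℝ) / M = 1 / M + 1 / M := by ring
        rw [h2]
        linarith [h.1]
      simp only [tent_eq_zero_of_res_eq_zero hres'', zero_pow two_ne_zero, zero_smul, zero_sub]
      have hrew : -(tent M y ^ 2 • c (blk M y)) - (tent M y ^ 2 • c (blk M y) - tent M (y - e μ) ^ 2 • c (blk M y))
          = (tent M (y - e μ) ^ 2 - 2 * tent M y ^ 2) • c (blk M y) := by
        rw [sub_smul, mul_smul, two_smul]; abel
      rw [hrew, norm_smul, Real.norm_eq_abs]
      have hcoef : |tent M (y - e μ) ^ 2 - 2 * tent M y ^ 2| ≤ 6 / (M : ℝ) ^ 2 := by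
        have ha : tent M (y - e μ) ^ 2 ≤ 4 / (M : ℝ) ^ 2 :=
          (pow_le_pow_left₀ (tent_nonneg hM1 _) hty' 2).trans (by rw [div_pow]; norm_num)
        have hb : tent M y ^ 2 ≤ 1 / (M : ℝ) ^ 2 :=
          (pow_le_pow_left₀ (tent_nonneg hM1 _) hty 2).trans (by rw [div_pow]; norm_num)
        have hq : 0 < 1 / (M : ℝ) ^ 2 := by positivity
        have e4 : 4 / (M : ℝ) ^ 2 = 4 * (1 / (M : ℝ) ^ 2) := by ring
        have e6 : 6 / (M : ℝ) ^ 2 = 6 * (1 / (M : ℝ) ^ 2) := by ring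
        rw [e4] at ha
        rw [e6, abs_le]
        constructor <;> nlinarith [sq_nonneg (tent M (y - e μ)), sq_nonneg (tent M y)]
      calc |tent M (y - e μ) ^ 2 - 2 * tent M y ^ 2| * ‖c (blk M y)‖ ≤ 6 / (M : ℝ) ^ 2 * ‖c (blk M y)‖ :=
            mul_le_mul_of_nonneg_right hcoef hcy
        _ ≤ (6 / (M : ℝ) ^ 2) * (‖c (blk M y)‖ + ‖c (blk M y)‖) :=
            mul_le_mul_of_nonneg_left (le_add_of_nonneg_left hcy) h6
    · -- interior: all three sites in the same block
      have hblk : blk M (y + e μ) = blk M y := by rw [blk_add_e hM1, if_neg h1, add_zero]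
      simp only [hblk]
      have hrew : tent M (y + e μ) ^ 2 • c (blk M y) - tent M y ^ 2 • c (blk M y)
            - (tent M y ^ 2 • c (blk M y) - tent M (y - e μ) ^ 2 • c (blk M y))
          = (tent M (y + e μ) ^ 2 - 2 * tent M y ^ 2 + tent M (y - e μ) ^ 2) • c (blk M y) := by
        rw [add_smul, sub_smul, mul_smul, two_smul]; abel
      rw [hrew, norm_smul, Real.norm_eq_abs]
      have h36 : 3 / (M : ℝ) ^ 2 ≤ 6 / (M : ℝ) ^ 2 := by gcongr; norm_num
      calc |tent M (y + e μ) ^ 2 - 2 * tent M y ^ 2 + tent M (y - e μ) ^ 2| * ‖c (blk M y)‖ ≤ 3 / (M : ℝ) ^ 2 * ‖c (blk M y)‖ :=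
            mul_le_mul_of_nonneg_right (abs_tentSq_sdiff_le hM1 h1 h0) hcy
        _ ≤ 6 / (M : ℝ) ^ 2 * ‖c (blk M y)‖ := mul_le_mul_of_nonneg_right h36 hcy
        _ ≤ (6 / (M : ℝ) ^ 2) * (‖c (blk M y)‖ + ‖c (blk M y)‖) :=
            mul_le_mul_of_nonneg_left (le_add_of_nonneg_left hcy) h6

/-- **THE FLAT-LAPLACIAN ENERGY OF THE SQUARED-TENT BUMP** over the torus of side `M·N` (`M ≥ 2`, `N ≥ 1`, `c` `N`-periodic):
`Σ_{y∈periodBox (M·N)} ‖Σ_μ (dPot (bump2 M c) y μ − dPot (bump2 M c) (y − e_μ) μ)‖² ≤ 144·d²·(M^d∕M⁴)·Σ_{z∈periodBox N} ‖c z‖²`. [folklore] -/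
theorem sum_normSq_lap_bump2_le {M : ℕ} (hM : 2 ≤ M) {N : ℕ} (hN : 1 ≤ N) {c : Site d → 𝔸}
    (hc : ∀ (z : Site d) (τ : Fin d), c (z + (N : ℤ) • e τ) = c z) :
    ∑ y ∈ periodBox (d := d) (M * N), ‖∑ μ : Fin d, (dPot (bump2 M c) y μ - dPot (bump2 M c) (y - e μ) μ)‖ ^ 2
      ≤ 144 * (d : ℝ) ^ 2 * ((M : ℝ) ^ d / (M : ℝ) ^ 4) * ∑ z ∈ periodBox (d := d) N, ‖c z‖ ^ 2 := by
  have hM1 : 1 ≤ M := by omega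
  have hM0 : (0 : ℝ) < M := by exact_mod_cast (by omega : 0 < M)
  have hMN : 1 ≤ M * N := Nat.one_le_iff_ne_zero.mpr (Nat.mul_ne_zero (by omega) (by omega))
  set C : ℝ := ∑ z ∈ periodBox (d := d) N, ‖c z‖ ^ 2 with hC
  -- pointwise: `‖s_μ‖² ≤ (72/M⁴)·(‖c(blk y)‖² + ‖c(blk (y − e_μ))‖²)`
  have hpt : ∀ (y : Site d) (μ : Fin d), ‖dPot (bump2 M c) y μ - dPot (bump2 M c) (y - e μ) μ‖ ^ 2
      ≤ 72 / (M : ℝ) ^ 4 * (‖c (blk M y)‖ ^ 2 + ‖c (blk M (y - e μ))‖ ^ 2) := by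
    intro y μ
    have h := norm_sdiff_bump2_le hM c y μ
    have ha := norm_nonneg (c (blk M y))
    have hb := norm_nonneg (c (blk M (y - e μ)))
    calc ‖dPot (bump2 M c) y μ - dPot (bump2 M c) (y - e μ) μ‖ ^ 2
        ≤ ((6 / (M : ℝ) ^ 2) * (‖c (blk M y)‖ + ‖c (blk M (y - e μ))‖)) ^ 2 := pow_le_pow_left₀ (norm_nonneg _) h 2
      _ = 36 / (M : ℝ) ^ 4 * (‖c (blk M y)‖ + ‖c (blk M (y - e μ))‖) ^ 2 := by ring
      _ ≤ 36 / (M : ℝ) ^ 4 * (2 * (‖c (blk M y)‖ ^ 2 + ‖c (blk M (y - e μ))‖ ^ 2)) :=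
          mul_le_mul_of_nonneg_left (by nlinarith [sq_nonneg (‖c (blk M y)‖ - ‖c (blk M (y - e μ))‖)]) (by positivity)
      _ = _ := by ring
  -- the block sum `Σ_y ‖c (blk y)‖² = M^d · C` and its shift
  have hblocks : ∑ y ∈ periodBox (d := d) (M * N), ‖c (blk M y)‖ ^ 2 = (M : ℝ) ^ d * C := by
    rw [← sum_periodBox_blocks M N hM1, hC, Finset.mul_sum]
    refine Finset.sum_congr rfl fun z _ => ?_
    rw [Finset.sum_congr rfl fun v hv => by rw [blk_block hM1 z hv], Finset.sum_const, card_periodBox, nsmul_eq_mul]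
    push_cast; ring
  have hshift : ∀ μ : Fin d, ∑ y ∈ periodBox (d := d) (M * N), ‖c (blk M (y - e μ))‖ ^ 2
      = ∑ y ∈ periodBox (d := d) (M * N), ‖c (blk M y)‖ ^ 2 := by
    intro μ
    have h := sum_periodBox_shift (M * N) hMN (g := fun y => ‖c (blk M y)‖ ^ 2) (fun y κ => normSq_blk_add_period hM1 hc y κ) (-e μ)
    refine Eq.trans (Finset.sum_congr rfl fun y _ => ?_) h
    rw [sub_eq_add_neg]
  have hsumμ : ∀ μ : Fin d, ∑ y ∈ periodBox (d := d) (M * N), ‖dPot (bump2 M c) y μ - dPot (bump2 M c) (y - e μ) μ‖ ^ 2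
      ≤ 72 / (M : ℝ) ^ 4 * (2 * ((M : ℝ) ^ d * C)) := by
    intro μ
    calc ∑ y ∈ periodBox (d := d) (M * N), ‖dPot (bump2 M c) y μ - dPot (bump2 M c) (y - e μ) μ‖ ^ 2
        ≤ ∑ y ∈ periodBox (d := d) (M * N), 72 / (M : ℝ) ^ 4 * (‖c (blk M y)‖ ^ 2 + ‖c (blk M (y - e μ))‖ ^ 2) :=
          Finset.sum_le_sum fun y _ => hpt y μ
      _ = 72 / (M : ℝ) ^ 4 * (∑ y ∈ periodBox (d := d) (M * N), ‖c (blk M y)‖ ^ 2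
            + ∑ y ∈ periodBox (d := d) (M * N), ‖c (blk M (y - e μ))‖ ^ 2) := by
          rw [← Finset.mul_sum, Finset.sum_add_distrib]
      _ = 72 / (M : ℝ) ^ 4 * (2 * ((M : ℝ) ^ d * C)) := by rw [hshift μ, hblocks]; ring
  calc ∑ y ∈ periodBox (d := d) (M * N), ‖∑ μ : Fin d, (dPot (bump2 M c) y μ - dPot (bump2 M c) (y - e μ) μ)‖ ^ 2
      ≤ ∑ y ∈ periodBox (d := d) (M * N), ((d : ℝ) * ∑ μ : Fin d, ‖dPot (bump2 M c) y μ - dPot (bump2 M c) (y - e μ) μ‖ ^ 2) :=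
        Finset.sum_le_sum fun y _ => by
          have h := normSq_sum_le_card_mul (Finset.univ : Finset (Fin d))
            (fun μ => dPot (bump2 M c) y μ - dPot (bump2 M c) (y - e μ) μ)
          rwa [Finset.card_univ, Fintype.card_fin] at h
    _ = (d : ℝ) * ∑ μ : Fin d, ∑ y ∈ periodBox (d := d) (M * N), ‖dPot (bump2 M c) y μ - dPot (bump2 M c) (y - e μ) μ‖ ^ 2 := by
        rw [← Finset.mul_sum, Finset.sum_comm]
    _ ≤ (d : ℝ) * ∑ _μ : Fin d, (72 / (M : ℝ) ^ 4 * (2 * ((M : ℝ) ^ d * C))) :=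
        mul_le_mul_of_nonneg_left (Finset.sum_le_sum fun μ _ => hsumμ μ) (Nat.cast_nonneg _)
    _ = 144 * (d : ℝ) ^ 2 * ((M : ℝ) ^ d / (M : ℝ) ^ 4) * C := by
        rw [Finset.sum_const, Finset.card_univ, Fintype.card_fin, nsmul_eq_mul]
        field_simp
        ring

end Bump

end

end Summit.QuantumFields.BalabanUV.T4Continuum.NE3SquaredTentBump
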